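import Summits.HodgeConjecture.HodgeConjecture.Theorems.F0P6bWDockWBlockLaw              -- ★ P6b W-DOCK PART 2 (`WBlockLaw.comp_comp_zsmul_id`) ⇒ ★ `Theorems.F0P6bWeilCartierDuality` (`e₀`, `theFamily`, `theFamily_isNatural`, `liftLam`, `e₀_hom_eq`)
import Literature.AlgebraicGeometry.AbelianSchemes.PolarisedIsogenyKernelShiftedIsotropic  -- ★ p849807 (LA3-p03): `comp_comp_cartierDualMap_eq_one_of_natural_of_zsmul_comp_eq_one`
import Literature.AlgebraicGeometry.Motives.AbelianVarietyTorsionFrobeniusPins             -- ★ `exists_torsionPin`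
import Literature.AlgebraicGeometry.AbelianSchemes.AbelianSchemeDualIsogenyHom              -- ★ `isMonHom_dualIsogenyOver`
import Literature.AlgebraicGeometry.GroupSchemes.CartierDualBlockReduction                  -- ★ `isMonHom_of_comp_mono`
import HarnessLib

/-!
# `F0P6bWeilShiftedIsotropy` — ★ RE-HOME (report-first cand v1, desk F0P6b-plan (g7)) of §1b «(I-iso) at the named duality `e₀`, all `T`» of the TREE leaflet
# `Cruxes/HLiu418/Lines/F0_P6a_RoofWInstantiation.lean` ED. 1 f62ef70b483c5730 :104–:215 (A-p03 (g32); there PASTED VERBATIM from «L3» LA3-p03 (g3)'s HOME pack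
# `F0/P6/L3/LA3-p03/g3/F0P6bWeilShiftedIsotropy.v1.LA3-p03g3.lean` 0e0aede77832ff49 and flagged «P6b may re-home»; A-p03 (g32) SEAT CLOSE 10:19:13Z: «GAP-2 ED. 2 only if P6b re-homes `hiso_e₀` (drop §1b → import)»).

`crux_decl: Summit.HodgeConjecture.HodgeConjecture.Theses.HCCMUnconditional.HLiu418`.  Cell `hodgecm-mathlib`, FLOOR 0, P6 «MOD programme», sub-desk P6b (the W-DOCK ∕ Weil–Cartier
family this row belongs to: it is a statement about the W-line's named duality `e₀` of ★ `Theorems/F0P6bWeilCartierDuality.lean` and uses ★ `Theorems/F0P6bWDockWBlockLaw.lean`'s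
`WBlockLaw.comp_comp_zsmul_id`).  THEOREMS lane (it imports `Summits.…Theorems.F0P6b*`, so it cannot be Literature — «M-72» (3) no cross-import); OWN namespace
`Summit.HodgeConjecture.HodgeConjecture.Cruxes.HLiu418.F0P6bWeilShiftedIsotropy` (the two names leave `…F0P6aRoofWInstantiation`; the only code consumer is that leaflet's own §3
:407 `hiso_e₀ …`, which its ED. 2 resolves with ONE `open …F0P6bWeilShiftedIsotropy (e₀_comp_cartierDualMap_eq_one_of_zsmul_comp_eq_one hiso_e₀)`; `rg` 10:2xZ: no other `.lean` use —
★ `Theorems/F0P6bWDockSeams.lean` :301 mentions (I-iso) in prose only).  CODE BYTES of the two theorems = the tree leaflet's :110–:214 VERBATIM (statements, docstrings, proofs);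
only the module header, the import list (the five modules §1b actually needs, instead of the leaflet's 13) and the namespace are new.  0 `sorry`, 0 `def`, 2 theorems; filed by a
PROVER hand `--supports stmt-HodgeConjecture-24832` (report-first; the desk does not file).  CONSUMER EDITION (K4-era, LA3-plan's pen): leaflet ED. 2 = ED. 1 − §1b (:104–:215)
− the three «(§1b)» imports :7–:9 + `import Summits.HodgeConjecture.HodgeConjecture.Theorems.F0P6bWeilShiftedIsotropy` + the `open` above; its 8 importers-by-closure re-made (D-chain ⇒ K4, LEAD «M-92a» (3)).
HC_CM is proved only modulo the 7 printed citations (2 remaining named inputs hLiu418 = stmt-HodgeConjecture-24832, h413 = stmt-HodgeConjecture-24833) until rung 0 closes; a re-home is count-neutral.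

* `e₀_comp_cartierDualMap_eq_one_of_zsmul_comp_eq_one` — (I-iso) at `e₀`, all `T`: `e₀(x₀)` is trivial on every closed subgroup `𝒦 ⊆ Ker q̄ ∩ A[q]` when `m·x₀ ∈ Ker q̄`, `p·m = q`;
* `hiso_e₀` — the same in the exact binder shape of ★ `WBlockLawED4c.hKW_of_isotropy_of_finrank` (layer action `β`, layers `jW`, `j𝒢`, kernel reading `κ`).

## References
* [MumfordAV1970] D. Mumford, *Abelian Varieties* (1970), §20 (I) (p. 186), §23 Thm. 2 (p. 231).
* [Tate1997FiniteFlatGroupSchemes] J. Tate, *Finite flat group schemes* (1997), §(3.8) (p. 145).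
* [Liu2021] Y. Liu, *Fourier–Jacobi cycles and arithmetic relative trace formula*, Camb. J. Math. 9 (2021), Prop. D.8 (3) pp. 136–138.
-/

set_option autoImplicit false
set_option linter.dupNamespace false

-- Mathlib's `Over`/`Scheme` APIs and the W-DOCK package are stated across semireducible wrappers (same option as the source leaflet).
set_option backward.isDefEq.respectTransparency false

noncomputable section

universe u

namespace Summit.HodgeConjecture.HodgeConjecture.Cruxes.HLiu418.F0P6bWeilShiftedIsotropy

open CategoryTheory CategoryTheory.Limits AlgebraicGeometry
open scoped MonoidalCategory MonObj CategoryTheory.Obj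
open Literature.AlgebraicGeometry.Motives (AlgPoints SchemeOver specOver)
open Literature.AlgebraicGeometry.GroupSchemes Literature.AlgebraicGeometry.GroupSchemes.GroupSchemeKernel
open Literature.AlgebraicGeometry.GroupSchemes.AffineGroupScheme Literature.AlgebraicGeometry.GroupSchemes.TorsionLayer
open Literature.AlgebraicGeometry.AbelianSchemes Literature.AlgebraicGeometry.AbelianSchemes.AbelianSchemeOver
open Literature.AlgebraicGeometry.AbelianSchemes.AbelianSchemeOver.DualPair
open Literature.AlgebraicGeometry.AbelianSchemes.WeilPairing
open Summit.HodgeConjecture.HodgeConjecture.Cruxes.HLiu418.F0P6bWeilCartierDuality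
open Summit.HodgeConjecture.HodgeConjecture.Cruxes.HLiu418.F0P6bWDock
open Literature.AlgebraicGeometry.Motives Literature.AlgebraicGeometry.Motives.AbelianVariety

/-- **(I-iso) AT `e₀`, ALL `T`-POINTS — «`e₀(x₀)` IS TRIVIAL ON EVERY CLOSED SUBGROUP `𝒦 ⊆ Ker q̄ ∩ A[q]` WHEN `m·x₀ ∈ Ker q̄`, `p·m = q`».**  For the W-DOCK datum
`(A, D, hD, pol, j : G = A[q] ↪ A, ĵ : Ĝ = Â[q] ↪ Â, hlam)`, the reduced leg `q̄ : A → B̄` with `(DB, hDB, λ_B̄)` and the reduced square law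
`q̄ ≫ λ_B̄ ≫ q̄^∨ = λ ≫ [p]`, a shift `m` (`p * m = p ^ r`), a closed subgroup `κ : 𝒦 ↪ G` with `κ ≫ j ≫ q̄ = 1`, and a `T`-point `x₀` of `G` with
`x₀ ≫ j ≫ (m • 𝟙 A) ≫ q̄ = 1`: `(x₀ ≫ e₀.hom) ≫ κ^D = 1`.  [MumfordAV1970] §20 (I) `e_q(q̄ x, ŷ) = e_q(x, q̄^∨ ŷ)` + §23 Thm. 2; proof through ★ p849807 and the
naturality of the W-line's family. [cite: MumfordAV1970, §20 (I) (p. 186); §23 Thm. 2 (p. 231)] [cite: Tate1997FiniteFlatGroupSchemes, §(3.8) p. 145]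
[cite: Liu2021, Prop. D.8 (3) pp. 136–138] -/
theorem e₀_comp_cartierDualMap_eq_one_of_zsmul_comp_eq_one
    {k : Type u} [Field k] [PerfectField k] (p : ℕ) [Fact p.Prime] [CharP k p] (r : ℕ)
    (A : AbelianSchemeOver (Spec (.of k))) (D : A.DualPair)
    (hD : Nonempty ((Scheme.Modules.pullback D.unitHatSlice).obj D.P ≅ SheafOfModules.unit _)) (pol : A.Polarization D)
    (G : SchemeOver k) [GrpObj G] [IsCommMonObj G] [IsAffine G.left] [Module.Free k (Alg G)] [Module.Finite k (Alg G)]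
    (j : G ⟶ A.X) [IsMonHom j] [IsClosedImmersion j.left]
    (hG : ∀ ⦃T : SchemeOver k⦄ (t : T ⟶ A.X), (∃ s : T ⟶ G, s ≫ j = t) ↔ t ≫ ((((p ^ r : ℕ) : ℤ) • 𝟙 A.toAffine.toAbelianVariety).hom.hom.hom) = 1)
    (Ĝ : SchemeOver k) [GrpObj Ĝ] [IsCommMonObj Ĝ] [IsAffine Ĝ.left] [Module.Free k (Alg Ĝ)] [Module.Finite k (Alg Ĝ)]
    (ĵ : Ĝ ⟶ D.hat.X) [IsMonHom ĵ] [IsClosedImmersion ĵ.left]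
    (hĜ : ∀ ⦃T : SchemeOver k⦄ (t : T ⟶ D.hat.X),
      (∃ s : T ⟶ Ĝ, s ≫ ĵ = t) ↔ t ≫ ((((p ^ r : ℕ) : ℤ) • 𝟙 D.hat.toAffine.toAbelianVariety).hom.hom.hom) = 1)
    (hlam : ∀ ⦃T : SchemeOver k⦄ (t : T ⟶ G), (t ≫ j) ≫ pol.lam = 1 → t = 1)
    -- the ROOF road's reduced leg `q̄ : A → B̄`, `B̄`'s normalised dual pair, `λ_B̄`, and the reduced square law (r3₀-q) at `[p]`
    {B : AbelianSchemeOver (Spec (.of k))} (qbar : A.X ⟶ B.X) [IsMonHom qbar] (DB : B.DualPair)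
    (hDB : Nonempty ((Scheme.Modules.pullback DB.unitHatSlice).obj DB.P ≅ SheafOfModules.unit _))
    (lamB : B.X ⟶ DB.hat.X) [IsMonHom lamB]
    (r3 : qbar ≫ lamB ≫ dualIsogenyOver qbar D DB = pol.lam ≫ D.hat.mulN p)
    -- the shift `m = p^{r−1}`
    (m : ℕ) (hm : p * m = p ^ r)
    -- a closed subgroup of `G = A[q]` killed by `q̄`
    {K : SchemeOver k} [GrpObj K] [IsCommMonObj K] [IsAffine K.left] [Module.Free k (Alg K)] [Module.Finite k (Alg K)]
    (κ : K ⟶ G) [IsMonHom κ] (hKq : (κ ≫ j) ≫ qbar = 1)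
    ⦃T : SchemeOver k⦄ (x₀ : T ⟶ G) (hx₀ : ((x₀ ≫ j) ≫ ((((m : ℕ) : ℤ) • 𝟙 A.toAffine.toAbelianVariety).hom.hom.hom)) ≫ qbar = 1) :
    (x₀ ≫ (e₀ p r A.toAffine.toAbelianVariety D pol j hG ĵ hĜ hlam).hom) ≫ cartierDualMap κ = 1 := by
  have hq0 : p ^ r ≠ 0 := pow_ne_zero _ (Fact.out : p.Prime).ne_zero
  haveI := pol.isMonHom
  haveI : Mono ĵ := mono_of_isClosedImmersion_left ĵ
  haveI : IsMonHom (dualIsogenyOver qbar D DB) := isMonHom_dualIsogenyOver qbar D DB hDB hD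
  -- realisations `B̄[q] ↪ B̄` and `B̂̄[q] ↪ B̂̄`
  obtain ⟨GB, _, _, _, _, _, jB, _, _, hGB⟩ := exists_torsionPin B.toAffine.toAbelianVariety hq0
  obtain ⟨ĜB, _, _, _, _, _, ĵB, _, _, hĜB⟩ := exists_torsionPin DB.hat.toAffine.toAbelianVariety hq0
  haveI : Mono jB := mono_of_isClosedImmersion_left jB
  -- the lift `β : G → B̄[q]` of `q̄` (`j ≫ q̄` is `q`-torsion)
  have hjq : (j ≫ qbar) ≫ ((((p ^ r : ℕ) : ℤ) • 𝟙 B.toAffine.toAbelianVariety).hom.hom.hom) = 1 := by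
    have hj : j ^ (p ^ r) = 1 := by rw [← comp_zsmul_id_hom_eq_pow']; exact (hG j).mp ⟨𝟙 G, Category.id_comp j⟩
    rw [comp_zsmul_id_hom_eq_pow', ← MonObj.pow_comp, hj, MonObj.one_comp]
  obtain ⟨β, hβ⟩ := (hGB (j ≫ qbar)).mpr hjq
  haveI : IsMonHom β := by
    haveI : IsMonHom (β ≫ jB) := by rw [hβ]; infer_instance
    exact isMonHom_of_comp_mono β jB
  -- the lift `β^d : B̂̄[q] → Â[q]` of `q̄^∨` (`ĵB ≫ q̄^∨` is `q`-torsion)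
  have hĵq : (ĵB ≫ dualIsogenyOver qbar D DB) ≫ ((((p ^ r : ℕ) : ℤ) • 𝟙 D.hat.toAffine.toAbelianVariety).hom.hom.hom) = 1 := by
    have hĵ : ĵB ^ (p ^ r) = 1 := by rw [← comp_zsmul_id_hom_eq_pow']; exact (hĜB ĵB).mp ⟨𝟙 ĜB, Category.id_comp ĵB⟩
    rw [comp_zsmul_id_hom_eq_pow', ← MonObj.pow_comp, hĵ, MonObj.one_comp]
  obtain ⟨βd, hβd⟩ := (hĜ (ĵB ≫ dualIsogenyOver qbar D DB)).mpr hĵq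
  -- the naturality square of the W-line's family at `f := q̄`
  have hnat := (theFamily_isNatural p r).2 A.toAffine.toAbelianVariety B.toAffine.toAbelianVariety D DB hD hDB (homOfIsMonHom qbar)
    G j hG Ĝ ĵ hĜ GB jB hGB ĜB ĵB hĜB β hβ βd hβd
  -- `𝒦` is killed by `β`
  have hK : κ ≫ β = 1 := by
    rw [← cancel_mono jB, Category.assoc, hβ, ← Category.assoc, hKq, MonObj.one_comp]
  rw [e₀_hom_eq]
  exact comp_comp_cartierDualMap_eq_one_of_natural_of_zsmul_comp_eq_one qbar D DB pol.lam lamB (p ^ r) p m j ĵ ĵB hĜB β βd hβd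
    (theFamily p r A.toAffine.toAbelianVariety D G j hG Ĝ ĵ hĜ).hom (theFamily p r B.toAffine.toAbelianVariety DB GB jB hGB ĜB ĵB hĜB).hom hnat
    (liftLam p r A.toAffine.toAbelianVariety D pol j hG ĵ hĜ) (liftLam_comp p r A.toAffine.toAbelianVariety D pol j hG ĵ hĜ) κ hK hq0 hm r3 x₀ hx₀

/-- **§2 `hiso_e₀` — (I-iso) IN THE EXACT BINDER SHAPE OF `hKW_of_isotropy_of_finrank`** (F0P6b-plan (g5) ED4c 2f3ac7e8), for ALL `T`: with the W-DOCK layer action `β`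
(only `β 1 = 𝟙`, `β (a + b) = β a · β b` are used, through `WBlockLaw.comp_comp_zsmul_id`), the `w`-layer `jW : W → G`, the `c•w`-layer `j𝒢 : 𝒢l → G` and its kernel
reading `κ : 𝒦 ↪ 𝒢l` KILLED BY `q̄` (`κ ≫ j𝒢 ≫ j ≫ q̄ = 1` — the (R3) reading «`𝒦 = Ker q̄ ∩ 𝒢l`», kills-half), the reduced square law (r3₀-q) at `[p]` and `1 ≤ r`:
`∀ x : T ⟶ W, (((x ≫ jW) ≫ β (p^{r−1})) ≫ j) ≫ q̄ = 1 → ((x ≫ jW) ≫ e₀.hom) ≫ (κ ≫ j𝒢)^D = 1`.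
[cite: MumfordAV1970, §20 (I) (p. 186); §23 Thm. 2 (p. 231)] [cite: Liu2021, Prop. D.8 (3) pp. 136–138] -/
theorem hiso_e₀
    {k : Type u} [Field k] [PerfectField k] (p : ℕ) [Fact p.Prime] [CharP k p] (r : ℕ) (hr : 1 ≤ r)
    (A : AbelianSchemeOver (Spec (.of k))) (D : A.DualPair)
    (hD : Nonempty ((Scheme.Modules.pullback D.unitHatSlice).obj D.P ≅ SheafOfModules.unit _)) (pol : A.Polarization D)
    {O : Type} [CommRing O]
    (G : SchemeOver k) [GrpObj G] [IsCommMonObj G] [IsAffine G.left] [Module.Free k (Alg G)] [Module.Finite k (Alg G)]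
    (j : G ⟶ A.X) [IsMonHom j] [IsClosedImmersion j.left]
    (hG : ∀ ⦃T : SchemeOver k⦄ (t : T ⟶ A.X), (∃ s : T ⟶ G, s ≫ j = t) ↔ t ≫ ((((p ^ r : ℕ) : ℤ) • 𝟙 A.toAffine.toAbelianVariety).hom.hom.hom) = 1)
    (Ĝ : SchemeOver k) [GrpObj Ĝ] [IsCommMonObj Ĝ] [IsAffine Ĝ.left] [Module.Free k (Alg Ĝ)] [Module.Finite k (Alg Ĝ)]
    (ĵ : Ĝ ⟶ D.hat.X) [IsMonHom ĵ] [IsClosedImmersion ĵ.left]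
    (hĜ : ∀ ⦃T : SchemeOver k⦄ (t : T ⟶ D.hat.X),
      (∃ s : T ⟶ Ĝ, s ≫ ĵ = t) ↔ t ≫ ((((p ^ r : ℕ) : ℤ) • 𝟙 D.hat.toAffine.toAbelianVariety).hom.hom.hom) = 1)
    (hlam : ∀ ⦃T : SchemeOver k⦄ (t : T ⟶ G), (t ≫ j) ≫ pol.lam = 1 → t = 1)
    -- the layer action (only its unital ∕ additive laws) and the two layers with the kernel reading
    (β : O → (G ⟶ G)) (hβ1 : β 1 = 𝟙 G) (hβadd : ∀ a b, β (a + b) = β a * β b)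
    (W : SchemeOver k) (jW : W ⟶ G)
    (𝒢l : SchemeOver k) [GrpObj 𝒢l] [IsCommMonObj 𝒢l] [IsAffine 𝒢l.left] [Module.Free k (Alg 𝒢l)] [Module.Finite k (Alg 𝒢l)]
    (j𝒢 : 𝒢l ⟶ G) [IsMonHom j𝒢]
    (𝒦 : SchemeOver k) [GrpObj 𝒦] [IsCommMonObj 𝒦] [IsAffine 𝒦.left] [Module.Free k (Alg 𝒦)] [Module.Finite k (Alg 𝒦)]
    (κ : 𝒦 ⟶ 𝒢l) [IsMonHom κ]
    -- the ROOF road's reduced leg with (r3₀-q) at `[p]`, and «`𝒦` is killed by `q̄`»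
    {B : AbelianSchemeOver (Spec (.of k))} (qbar : A.X ⟶ B.X) [IsMonHom qbar] (DB : B.DualPair)
    (hDB : Nonempty ((Scheme.Modules.pullback DB.unitHatSlice).obj DB.P ≅ SheafOfModules.unit _))
    (lamB : B.X ⟶ DB.hat.X) [IsMonHom lamB]
    (r3 : qbar ≫ lamB ≫ dualIsogenyOver qbar D DB = pol.lam ≫ D.hat.mulN p)
    (h𝒦 : ((κ ≫ j𝒢) ≫ j) ≫ qbar = 1)
    ⦃T : SchemeOver k⦄ (x : T ⟶ W) (hx : (((x ≫ jW) ≫ β ((p ^ (r - 1) : ℕ) : O)) ≫ j) ≫ qbar = 1) :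
    ((x ≫ jW) ≫ (e₀ p r A.toAffine.toAbelianVariety D pol j hG ĵ hĜ hlam).hom) ≫ cartierDualMap (κ ≫ j𝒢) = 1 := by
  have hm : p * p ^ (r - 1) = p ^ r := by
    rw [← pow_succ']
    congr 1
    omega
  refine e₀_comp_cartierDualMap_eq_one_of_zsmul_comp_eq_one p r A D hD pol G j hG Ĝ ĵ hĜ hlam qbar DB hDB lamB r3 (p ^ (r - 1)) hm (κ ≫ j𝒢) h𝒦
    (x ≫ jW) ?_
  rw [Summit.HodgeConjecture.HodgeConjecture.Cruxes.HLiu418.F0P6bWDock.WBlockLaw.comp_comp_zsmul_id A G j β hβ1 hβadd (p ^ (r - 1)) (x ≫ jW)]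
  exact hx


end Summit.HodgeConjecture.HodgeConjecture.Cruxes.HLiu418.F0P6bWeilShiftedIsotropy
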